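import Summits.HodgeConjecture.HodgeCM.PerL34.PseudoEisenstein_1

/-! PORT of `HodgeCM/PerL34/PseudoEisenstein.lean` (HodgeCMPerL run 82) — part 2: continuation of `Summits.HodgeConjecture.HodgeCM.PerL34.PseudoEisenstein_1` (split at a top-level declaration boundary by port_pkg.py; scope re-opened below; declarations unchanged). -/

-- port_pkg: scope re-opened for this part (file-level context, then the namespace/section stack open at the cut)
set_option autoImplicit false
noncomputable section
open MeasureTheory Set Filter Function
open scoped Pointwise ENNReal
namespace HodgeCM
namespace PerL34
namespace N23a
section Unfolding
variable {G : Type*} [Group G] [TopologicalSpace G] [IsTopologicalGroup G] [T2Space G]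
  [MeasurableSpace G] [BorelSpace G]
  {T : Type*} [Group T] [TopologicalSpace T] [T2Space T] [MeasurableSpace T] [OpensMeasurableSpace T]
/-- **Unfolding** (the computation behind tex ll. 415–417 and 424–425).  For `K : G → ℂ` continuous and
left-`Γ`-invariant,
`∫_{[U(W)]} E^χ_f(y) K(y) dy = ∫_{U(W)(𝔸)} f(h) (∫_{[T]} K(t h) χ(t) dt) dh`,
with `[U(W)]` realised by the fundamental domain `𝓕` and `∫_{[T]} (·) χ dt` by `∫_T β χ (·) dν`.
Only LEFT invariance of `μ` is used (no unimodularity), and nothing about `ν` beyond finiteness on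
compact sets. -/
theorem unfolding
    (μ : Measure G) [μ.IsMulLeftInvariant] [IsFiniteMeasureOnCompacts μ]
    (ν : Measure T) [IsFiniteMeasureOnCompacts ν]
    (jT : T →* G) (hjT : Continuous jT)
    (β : T → ℝ) (hβ : Continuous β) (hβs : HasCompactSupport β)
    (χ : T → ℂ) (hχ : Continuous χ)
    (Γ : Subgroup G) [Countable Γ] (𝓕 : Set G) (h𝓕 : IsFundamentalDomain Γ 𝓕 μ)
    (f : G → ℂ) (hf : Continuous f) (hfs : HasCompactSupport f)
    (K : G → ℂ) (hK : Continuous K) (hKinv : ∀ (γ : Γ) (y : G), K ((γ : G) * y) = K y) :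
    ∫ y in 𝓕, Eis ν jT β χ Γ f y * K y ∂μ = ∫ h, f h * toricPeriod ν jT β χ K h ∂μ := by
  -- abbreviations
  have hXc : Continuous (Xiβ ν jT β χ f) := continuous_Xiβ ν jT hjT β hβ hβs χ hχ f hf
  have hXs : HasCompactSupport (Xiβ ν jT β χ f) := hasCompactSupport_Xiβ ν jT hjT β hβs χ f hfs
  have hint : Integrable (fun x => Xiβ ν jT β χ f x * K x) μ :=
    (hXc.mul hK).integrable_of_hasCompactSupport hXs.mul_right
  have hwt : Continuous (wt β χ) := continuous_wt hβ hχ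
  -- (1) unfold the `Γ`-sum against the fundamental domain
  have step1 : ∫ y in 𝓕, Eis ν jT β χ Γ f y * K y ∂μ
      = ∫ y in 𝓕, ∑' γ : Γ, Xiβ ν jT β χ f ((γ : G) * y) * K y ∂μ := by
    simp only [Eis, tsum_mul_right]
  have hmeas : ∀ γ : Γ, AEStronglyMeasurable (fun y => Xiβ ν jT β χ f ((γ : G) * y) * K y)
      (μ.restrict 𝓕) := by
    intro γ
    exact ((hXc.comp (continuous_const.mul continuous_id)).mul hK).aestronglyMeasurable
  have hfin : ∑' γ : Γ, ∫⁻ y in 𝓕, ‖Xiβ ν jT β χ f ((γ : G) * y) * K y‖ₑ ∂μ ≠ ∞ := by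
    have h := h𝓕.lintegral_eq_tsum'' (fun x => ‖Xiβ ν jT β χ f x * K x‖ₑ)
    simp only [Subgroup.smul_def, smul_eq_mul, hKinv] at h
    rw [← h]
    exact hint.2.ne
  have step2 : ∫ y in 𝓕, ∑' γ : Γ, Xiβ ν jT β χ f ((γ : G) * y) * K y ∂μ
      = ∑' γ : Γ, ∫ y in 𝓕, Xiβ ν jT β χ f ((γ : G) * y) * K y ∂μ :=
    integral_tsum hmeas hfin
  have step3 : ∑' γ : Γ, ∫ y in 𝓕, Xiβ ν jT β χ f ((γ : G) * y) * K y ∂μ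
      = ∫ x, Xiβ ν jT β χ f x * K x ∂μ := by
    have h := h𝓕.integral_eq_tsum'' (fun x => Xiβ ν jT β χ f x * K x) hint
    simp only [Subgroup.smul_def, smul_eq_mul, hKinv] at h
    exact h.symm
  -- (2) write `Ξ_β · K` as an inner `T`-integral and swap (Fubini, compact support)
  have step4 : ∫ x, Xiβ ν jT β χ f x * K x ∂μ
      = ∫ x, ∫ t, wt β χ t * (f ((jT t)⁻¹ * x) * K x) ∂ν ∂μ := by
    congr 1
    ext x
    rw [Xiβ, ← integral_mul_const]
    congr 1
    ext t
    ring
  have hF₂c : Continuous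
      (Function.uncurry fun (t : T) (x : G) => wt β χ t * (f ((jT t)⁻¹ * x) * K x)) := by
    change Continuous fun p : T × G => wt β χ p.1 * (f ((jT p.1)⁻¹ * p.2) * K p.2)
    exact (hwt.comp continuous_fst).mul
      ((hf.comp (((hjT.comp continuous_fst).inv).mul continuous_snd)).mul (hK.comp continuous_snd))
  have hF₂s : HasCompactSupport
      (Function.uncurry fun (t : T) (x : G) => wt β χ t * (f ((jT t)⁻¹ * x) * K x)) := by
    apply HasCompactSupport.intro
      (hβs.isCompact.prod ((hβs.isCompact.image hjT).mul hfs.isCompact))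
    rintro ⟨t, x⟩ hp
    change wt β χ t * (f ((jT t)⁻¹ * x) * K x) = 0
    by_cases ht : t ∈ tsupport β
    · have hx : x ∉ ((jT : T → G) '' tsupport β) * tsupport f := by
        intro hx
        exact hp (Set.mk_mem_prod ht hx)
      have hf0 : f ((jT t)⁻¹ * x) = 0 := by
        apply image_eq_zero_of_notMem_tsupport
        intro hmem
        apply hx
        refine Set.mem_mul.mpr ⟨jT t, Set.mem_image_of_mem _ ht, (jT t)⁻¹ * x, hmem, ?_⟩
        simp
      simp [hf0]
    · simp [wt_eq_zero_of_notMem β χ ht]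
  have step5 : ∫ x, ∫ t, wt β χ t * (f ((jT t)⁻¹ * x) * K x) ∂ν ∂μ
      = ∫ t, ∫ x, wt β χ t * (f ((jT t)⁻¹ * x) * K x) ∂μ ∂ν :=
    (integral_integral_swap_of_hasCompactSupport hF₂c hF₂s).symm
  -- (3) left invariance of `μ`: substitute `x = jT(t) h`
  have step6 : ∀ t : T, ∫ x, wt β χ t * (f ((jT t)⁻¹ * x) * K x) ∂μ
      = ∫ h, f h * (wt β χ t * K (jT t * h)) ∂μ := by
    intro t
    rw [← integral_mul_left_eq_self (fun x => wt β χ t * (f ((jT t)⁻¹ * x) * K x)) (jT t)]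
    congr 1
    ext h
    simp only [inv_mul_cancel_left]
    ring
  have step7 : ∫ t, ∫ x, wt β χ t * (f ((jT t)⁻¹ * x) * K x) ∂μ ∂ν
      = ∫ t, ∫ h, f h * (wt β χ t * K (jT t * h)) ∂μ ∂ν := by
    congr 1
    ext t
    exact step6 t
  -- (4) swap back (Fubini, compact support) and recognise the toric period
  have hF₁c : Continuous
      (Function.uncurry fun (t : T) (h : G) => f h * (wt β χ t * K (jT t * h))) := by
    change Continuous fun p : T × G => f p.2 * (wt β χ p.1 * K (jT p.1 * p.2))
    exact (hf.comp continuous_snd).mul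
      ((hwt.comp continuous_fst).mul (hK.comp ((hjT.comp continuous_fst).mul continuous_snd)))
  have hF₁s : HasCompactSupport
      (Function.uncurry fun (t : T) (h : G) => f h * (wt β χ t * K (jT t * h))) := by
    apply HasCompactSupport.intro (hβs.isCompact.prod hfs.isCompact)
    rintro ⟨t, h⟩ hp
    change f h * (wt β χ t * K (jT t * h)) = 0
    by_cases ht : t ∈ tsupport β
    · have hh : h ∉ tsupport f := fun hh => hp (Set.mk_mem_prod ht hh)
      simp [image_eq_zero_of_notMem_tsupport hh]
    · simp [wt_eq_zero_of_notMem β χ ht]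
  have step8 : ∫ t, ∫ h, f h * (wt β χ t * K (jT t * h)) ∂μ ∂ν
      = ∫ h, ∫ t, f h * (wt β χ t * K (jT t * h)) ∂ν ∂μ :=
    integral_integral_swap_of_hasCompactSupport hF₁c hF₁s
  have step9 : ∫ h, ∫ t, f h * (wt β χ t * K (jT t * h)) ∂ν ∂μ
      = ∫ h, f h * toricPeriod ν jT β χ K h ∂μ := by
    congr 1
    ext h
    rw [toricPeriod, integral_const_mul]
  rw [step1, step2, step3, step4, step5, step7, step8, step9]

/-- **Step 1 display** (tex ll. 415–417).  `θ x : G → ℂ` is the theta kernel `y ↦ θ_Φ(g,y)` at the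
fixed `g`, for `Φ = x` in the index set `X` (the Schwartz space), `ω h : X → X` the Weil action of
`h ∈ U(W)(𝔸)`, and the equivariance `θ_Φ(g, t h) = θ_{ω(h)Φ}(g, t)` of l. 414 is the hypothesis `hθω`.
Then `𝒯_Φ(E^χ_f)(g) = ∫ f(h) ϑ_{T,χ}(ω(h)Φ)(g) dh` with `ϑ_{T,χ}(Φ')(g) = ∫_{[T]} θ_{Φ'}(g,t) χ(t) dt`. -/
theorem unfolding_theta
    (μ : Measure G) [μ.IsMulLeftInvariant] [IsFiniteMeasureOnCompacts μ]
    (ν : Measure T) [IsFiniteMeasureOnCompacts ν]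
    (jT : T →* G) (hjT : Continuous jT)
    (β : T → ℝ) (hβ : Continuous β) (hβs : HasCompactSupport β)
    (χ : T → ℂ) (hχ : Continuous χ)
    (Γ : Subgroup G) [Countable Γ] (𝓕 : Set G) (h𝓕 : IsFundamentalDomain Γ 𝓕 μ)
    (f : G → ℂ) (hf : Continuous f) (hfs : HasCompactSupport f)
    {X : Type*} (θ : X → G → ℂ) (ω : G → X → X) (x : X)
    (hθ : Continuous (θ x)) (hθinv : ∀ (γ : Γ) (y : G), θ x ((γ : G) * y) = θ x y)
    (hθω : ∀ (h : G) (t : T), θ x (jT t * h) = θ (ω h x) (jT t)) :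
    ∫ y in 𝓕, θ x y * Eis ν jT β χ Γ f y ∂μ
      = ∫ h, f h * (∫ t, wt β χ t * θ (ω h x) (jT t) ∂ν) ∂μ := by
  have h := unfolding μ ν jT hjT β hβ hβs χ hχ Γ 𝓕 h𝓕 f hf hfs (θ x) hθ hθinv
  simp only [toricPeriod, hθω] at h
  simpa only [mul_comm] using h

/-- **Step 2 display** (tex ll. 424–425).  For a smooth (hence continuous, l. 391) vector `v`, viewed as
a left-`Γ`-invariant continuous function on `G`, with `⟨u, v⟩ = ∫_{[U(W)]} u v̄` and
`P_{T,χ̄}(u) := ∫_{[T]} u(t) χ(t) dt` (the `χ̄`-coefficient pairs against `conj χ̄ = χ`):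
`⟨E^χ_f, v⟩ = ∫_{U(W)(𝔸)} f(h) conj(P_{T,χ̄}(R(h)v)) dh`, where `(R(h)v)(t) = v(t h)`. -/
theorem unfolding_inner
    (μ : Measure G) [μ.IsMulLeftInvariant] [IsFiniteMeasureOnCompacts μ]
    (ν : Measure T) [IsFiniteMeasureOnCompacts ν]
    (jT : T →* G) (hjT : Continuous jT)
    (β : T → ℝ) (hβ : Continuous β) (hβs : HasCompactSupport β)
    (χ : T → ℂ) (hχ : Continuous χ)
    (Γ : Subgroup G) [Countable Γ] (𝓕 : Set G) (h𝓕 : IsFundamentalDomain Γ 𝓕 μ)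
    (f : G → ℂ) (hf : Continuous f) (hfs : HasCompactSupport f)
    (v : G → ℂ) (hv : Continuous v) (hvinv : ∀ (γ : Γ) (y : G), v ((γ : G) * y) = v y) :
    ∫ y in 𝓕, Eis ν jT β χ Γ f y * (starRingEnd ℂ) (v y) ∂μ
      = ∫ h, f h * (starRingEnd ℂ) (∫ t, ((β t : ℂ) * (starRingEnd ℂ) (χ t)) * v (jT t * h) ∂ν) ∂μ := by
  have hK : Continuous fun y => (starRingEnd ℂ) (v y) := Complex.continuous_conj.comp hv
  have hKinv : ∀ (γ : Γ) (y : G), (starRingEnd ℂ) (v ((γ : G) * y)) = (starRingEnd ℂ) (v y) := by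
    intro γ y; rw [hvinv]
  have h := unfolding μ ν jT hjT β hβ hβs χ hχ Γ 𝓕 h𝓕 f hf hfs (fun y => (starRingEnd ℂ) (v y)) hK hKinv
  rw [h]
  congr 1
  ext h'
  congr 1
  rw [toricPeriod, ← integral_conj]
  congr 1
  ext t
  simp only [wt, map_mul, Complex.conj_ofReal, Complex.conj_conj]

end Unfolding

/-! ## Fidelity: PerL's full torus integral `Ξ^χ_f` versus the truncated `Ξ_β` -/

section Fidelity

variable {G : Type*} [Group G] [TopologicalSpace G] [IsTopologicalGroup G]
  {T : Type*} [Group T] [TopologicalSpace T] [IsTopologicalGroup T]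
  [MeasurableSpace T] [BorelSpace T]

omit [MeasurableSpace T] [BorelSpace T] in
/-- PerL's integrand `t ↦ χ(t) f(t⁻¹ y)` on `T(𝔸)` is continuous with compact support when `T(𝔸) → U(W)(𝔸)`
is proper (a closed subgroup) and `f ∈ C_c`: "compactly supported modulo `T(𝔸)`" read on `T`. -/
theorem hasCompactSupport_torusIntegrand (jT : T →* G)
    (hprop : ∀ C : Set G, IsCompact C → IsCompact ((jT : T → G) ⁻¹' C))
    (χ : T → ℂ) (f : G → ℂ) (hfs : HasCompactSupport f) (y : G) :
    HasCompactSupport fun t : T => χ t * f ((jT t)⁻¹ * y) := by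
  have hC : IsCompact ((jT : T → G) ⁻¹' ((fun x : G => y * x⁻¹) '' tsupport f)) :=
    hprop _ (hfs.isCompact.image (continuous_const.mul continuous_inv))
  apply HasCompactSupport.intro hC
  intro t ht
  have hf0 : f ((jT t)⁻¹ * y) = 0 := by
    apply image_eq_zero_of_notMem_tsupport
    intro hmem
    apply ht
    refine ⟨(jT t)⁻¹ * y, hmem, ?_⟩
    simp
  simp [hf0]

/-- **Fidelity to PerL's definition** (tex ll. 406–408).  If `Γ_T ≤ T` is a countable subgroup, `χ` is
left-`Γ_T`-invariant (a character of `[T] = T(L₀)\T(𝔸)`) and `β ≥ 0` is a continuous compactly supported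
`Γ_T`-partition of unity (`Σ_δ β(δ t) = 1`, which is where compactness of `T(L₀)\T(𝔸)` enters), then
PerL's full torus integral is the `Γ_T`-periodisation of the truncated transform:
`Ξ^χ_f(y) = Σ_{δ ∈ Γ_T} Ξ_β(jT(δ)⁻¹ y)`.  Hence, regrouping the locally finite sum `Σ_{γ ∈ Γ} Ξ_β(γ y)`
along the cosets `jT(Γ_T) γ` (for `jT(Γ_T) ≤ Γ`), `Eis` is PerL's `E^χ_f = Σ_{T(L₀)\U(W)(L₀)} Ξ^χ_f(γ y)`
verbatim. -/
theorem Xi_eq_tsum_Xiβ (ν : Measure T) [ν.IsMulLeftInvariant] [IsFiniteMeasureOnCompacts ν]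
    (jT : T →* G) (hjT : Continuous jT)
    (hprop : ∀ C : Set G, IsCompact C → IsCompact ((jT : T → G) ⁻¹' C))
    (β : T → ℝ) (hβ : Continuous β) (hβnn : ∀ t, 0 ≤ β t)
    (ΓT : Subgroup T) [Countable ΓT]
    (hβsum : ∀ t, HasSum (fun δ : ΓT => β ((δ : T) * t)) 1)
    (χ : T → ℂ) (hχ : Continuous χ) (hχinv : ∀ (δ : ΓT) (t : T), χ ((δ : T) * t) = χ t)
    (f : G → ℂ) (hf : Continuous f) (hfs : HasCompactSupport f) (y : G) :
    Xi ν jT χ f y = ∑' δ : ΓT, Xiβ ν jT β χ f ((jT δ)⁻¹ * y) := by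
  -- the integrand of PerL's `Ξ` and its integrability
  set g : T → ℂ := fun s => χ s * f ((jT s)⁻¹ * y) with hg
  have hgc : Continuous g := hχ.mul (hf.comp ((hjT.inv).mul continuous_const))
  have hgs : HasCompactSupport g := hasCompactSupport_torusIntegrand jT hprop χ f hfs y
  have hgi : Integrable g ν := hgc.integrable_of_hasCompactSupport hgs
  -- partition of unity, reindexed by inversion
  have hsum' : ∀ s : T, HasSum (fun δ : ΓT => β ((δ : T)⁻¹ * s)) 1 := by
    intro s
    have h := (hβsum s)
    rw [← (Equiv.inv ΓT).hasSum_iff] at h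
    simpa only [Equiv.inv_apply, Function.comp_def, Subgroup.coe_inv] using h
  -- (i) each term, after the substitution `t = δ⁻¹ s`
  have hterm : ∀ δ : ΓT,
      Xiβ ν jT β χ f ((jT δ)⁻¹ * y) = ∫ s, (β ((δ : T)⁻¹ * s) : ℂ) * g s ∂ν := by
    intro δ
    rw [← integral_mul_left_eq_self (fun s => (β ((δ : T)⁻¹ * s) : ℂ) * g s) (δ : T)]
    unfold Xiβ wt
    congr 1
    ext t
    simp only [hg, inv_mul_cancel_left, map_mul, mul_inv_rev, hχinv, mul_assoc]
  simp_rw [hterm]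
  -- (ii) interchange sum and integral
  have hmeas : ∀ δ : ΓT, AEStronglyMeasurable (fun s => (β ((δ : T)⁻¹ * s) : ℂ) * g s) ν := by
    intro δ
    exact ((Complex.continuous_ofReal.comp (hβ.comp (continuous_const.mul continuous_id))).mul
      hgc).aestronglyMeasurable
  have hpt : ∀ s : T, ∑' δ : ΓT, ‖(β ((δ : T)⁻¹ * s) : ℂ) * g s‖ₑ = ‖g s‖ₑ := by
    intro s
    have h1 : ∀ δ : ΓT, ‖(β ((δ : T)⁻¹ * s) : ℂ) * g s‖ₑ
        = ENNReal.ofReal (β ((δ : T)⁻¹ * s)) * ‖g s‖ₑ := by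
      intro δ
      rw [enorm_mul]
      congr 1
      rw [← ofReal_norm, Complex.norm_real, Real.norm_of_nonneg (hβnn _)]
    simp_rw [h1]
    rw [ENNReal.tsum_mul_right, ← ENNReal.ofReal_tsum_of_nonneg (fun δ => hβnn _) (hsum' s).summable,
      (hsum' s).tsum_eq, ENNReal.ofReal_one, one_mul]
  have hfin : ∑' δ : ΓT, ∫⁻ s, ‖(β ((δ : T)⁻¹ * s) : ℂ) * g s‖ₑ ∂ν ≠ ∞ := by
    rw [← lintegral_tsum (fun δ => (hmeas δ).enorm)]
    simp_rw [hpt]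
    exact hgi.2.ne
  rw [← integral_tsum hmeas hfin]
  -- (iii) the partition of unity sums to one
  unfold Xi
  congr 1
  ext s
  rw [tsum_mul_right, ← Complex.ofReal_tsum, (hsum' s).tsum_eq, Complex.ofReal_one, one_mul]

/-- **PerL's `E^χ_f` verbatim** (tex l. 408): `E^χ_f(y) = Σ_{γ ∈ T(L₀)\U(W)(L₀)} Ξ^χ_f(γ y)`.
Here `s : Q → G` is any system of representatives of the cosets `T(L₀)\U(W)(L₀)`: the hypothesis
`e : Γ_T × Q ≃ Γ` with `e(δ,q) = jT(δ)·s(q)` says exactly that `U(W)(L₀) = ⊔_q T(L₀) s(q)` (and that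
`T(L₀) → U(W)(L₀)` is injective).  Conclusion: the coset sum of the FULL torus integrals equals the
sum over ALL of `Γ` of the truncated ones, i.e. `Eis` — a regrouping of a finitely supported sum
(`Eis_support_finite`) combined with `Xi_eq_tsum_Xiβ`. -/
theorem Eis_eq_cosetSum [T2Space G] (ν : Measure T) [ν.IsMulLeftInvariant]
    [IsFiniteMeasureOnCompacts ν]
    (jT : T →* G) (hjT : Continuous jT)
    (hprop : ∀ C : Set G, IsCompact C → IsCompact ((jT : T → G) ⁻¹' C))
    (β : T → ℝ) (hβ : Continuous β) (hβs : HasCompactSupport β) (hβnn : ∀ t, 0 ≤ β t)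
    (ΓT : Subgroup T) [Countable ΓT]
    (hβsum : ∀ t, HasSum (fun δ : ΓT => β ((δ : T) * t)) 1)
    (χ : T → ℂ) (hχ : Continuous χ) (hχinv : ∀ (δ : ΓT) (t : T), χ ((δ : T) * t) = χ t)
    (Γ : Subgroup G) (hΓ : DiscreteMeets Γ)
    {Q : Type*} (s : Q → G) (e : ΓT × Q ≃ Γ) (he : ∀ (δ : ΓT) (q : Q), ((e (δ, q) : Γ) : G) = jT δ * s q)
    (f : G → ℂ) (hf : Continuous f) (hfs : HasCompactSupport f) (y : G) :
    ∑' q : Q, Xi ν jT χ f (s q * y) = Eis ν jT β χ Γ f y := by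
  -- the `Γ`-sum has finite support, hence is unconditionally summable, and so is its transport
  set F : Γ → ℂ := fun γ => Xiβ ν jT β χ f ((γ : G) * y) with hF
  have hFfin : (Function.support F).Finite := Eis_support_finite ν jT hjT β hβs χ Γ hΓ f hfs y
  set F' : Q × ΓT → ℂ := fun p => F (e (p.2, p.1)) with hF'
  have hinj : Function.Injective fun p : Q × ΓT => e (p.2, p.1) := by
    intro p₁ p₂ h
    have h' := e.injective h
    simp only [Prod.mk.injEq] at h'
    exact Prod.ext h'.2 h'.1
  have hF'fin : (Function.support F').Finite := by
    have : Function.support F' ⊆ (fun p : Q × ΓT => e (p.2, p.1)) ⁻¹' Function.support F := by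
      intro p hp; exact hp
    exact (hFfin.preimage hinj.injOn).subset this
  have hF's : Summable F' := summable_of_hasFiniteSupport hF'fin
  have hfib : ∀ q : Q, Summable fun δ : ΓT => F' (q, δ) := by
    intro q
    apply summable_of_hasFiniteSupport
    have : Function.support (fun δ : ΓT => F' (q, δ)) ⊆ Prod.snd '' Function.support F' := by
      intro δ hδ
      exact ⟨(q, δ), hδ, rfl⟩
    exact (hF'fin.image Prod.snd).subset this
  -- regroup: Σ_Γ = Σ_q Σ_δ
  have hre : Eis ν jT β χ Γ f y = ∑' p : Q × ΓT, F' p := by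
    unfold Eis
    have h1 : ∑' γ : Γ, F γ = ∑' p : ΓT × Q, F (e p) := (e.tsum_eq F).symm
    have h2 : ∑' p : ΓT × Q, F (e p) = ∑' p : Q × ΓT, F (e (p.2, p.1)) :=
      ((Equiv.prodComm Q ΓT).tsum_eq (fun p : ΓT × Q => F (e p))).symm
    rw [hF'] ; exact h1.trans h2
  rw [hre, hF's.tsum_prod' hfib]
  congr 1
  ext q
  -- inner sum: Σ_δ Ξ_β(jT δ s(q) y) = Ξ(s(q) y) by fidelity, after δ ↦ δ⁻¹
  rw [Xi_eq_tsum_Xiβ ν jT hjT hprop β hβ hβnn ΓT hβsum χ hχ hχinv f hf hfs (s q * y)]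
  rw [← (Equiv.inv ΓT).tsum_eq]
  congr 1
  ext δ
  simp only [hF', hF, he, Equiv.inv_apply, Subgroup.coe_inv, map_inv, inv_inv, mul_assoc]

end Fidelity

/-! ## The closed span `𝓔` is `R(U(W)(𝔸))`-invariant (tex ll. 410–411) -/

section SpanClosure

variable {H : Type*} [AddCommGroup H] [Module ℂ H] [TopologicalSpace H] [IsTopologicalAddGroup H]
  [ContinuousSMul ℂ H]

/-- If a continuous linear operator `R` maps a set of vectors `S` into itself (as `R(h₀)` maps the
family of pseudo-Eisenstein series into itself by `Eis_rTrans`: `R(h₀)E^χ_f = E^χ_{f^{h₀}}`), then it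
preserves the closure `𝓔̄` of the span `𝓔` of `S` (tex ll. 410–411). -/
theorem closureSpan_invariant (R : H →L[ℂ] H) (S : Set H) (hS : Set.MapsTo R S S) :
    Set.MapsTo R ((Submodule.span ℂ S).topologicalClosure : Set H)
      ((Submodule.span ℂ S).topologicalClosure : Set H) := by
  have hspan : Set.MapsTo R (Submodule.span ℂ S : Set H) (Submodule.span ℂ S : Set H) := by
    intro x hx
    have hle : Submodule.map (R : H →ₗ[ℂ] H) (Submodule.span ℂ S) ≤ Submodule.span ℂ S := by
      rw [Submodule.map_span]
      exact Submodule.span_mono hS.image_subset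
    exact hle ⟨x, hx, rfl⟩
  intro x hx
  rw [Submodule.topologicalClosure_coe] at hx ⊢
  exact map_mem_closure R.continuous hx hspan

end SpanClosure

/-! ## The fundamental lemma and the consequence form of Step 2's unfolding
(tex ll. 423–426: from `⟨E^χ_f, v⟩ = 0` for all `f`, "hence `h ↦ P_{T,χ̄}(R(h)v)` … is `≡ 0`") -/

section FundamentalLemma

variable {G : Type*} [TopologicalSpace G] [T2Space G] [LocallyCompactSpace G]
  [MeasurableSpace G] [OpensMeasurableSpace G]


-- port_pkg: scope closed for this part
end FundamentalLemma
end N23a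
end PerL34
end HodgeCM
end
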